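import Mathlib.Analysis.Calculus.LineDeriv.IntegrationByParts
import Mathlib.Analysis.Calculus.FDeriv.Symmetric
import Mathlib.Analysis.Calculus.ContDiff.Basic
import HarnessLib

/-!
# The `div`–`curl` identity for compactly supported planar fields

Topic `Literature/Analysis/Calculus` (namespace `Literature.Analysis.Calculus`). For two
compactly supported functions `a, b` on a finite-dimensional real vector space `E` with a Haar
measure `μ` and two directions `v, w ∈ E`, writing `f_v = Df(·) v` for directional derivatives,

* `integral_fderiv_mul_fderiv_comm`: `∫ a_v b_w dμ = ∫ a_w b_v dμ` (`a ∈ C¹_c`, `b ∈ C²`):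
  integrate by parts in the direction `v`, exchange the mixed second derivatives of `b`, and
  integrate by parts in the direction `w`;
* `integral_div_sq_add_curl_sq`: `∫ ((a_v + b_w)² + (a_w - b_v)²) dμ = ∫ (a_v² + a_w² + b_v² + b_w²) dμ`
  (`a ∈ C¹_c`, `b ∈ C²_c`): the cross terms cancel by the first identity.

For `E = ℝ²`, `v = e₁`, `w = e₂` and the planar field `Ṽ = (a, b)` this is the classical
identity `‖∇Ṽ‖²_{L²} = ‖div Ṽ‖²_{L²} + ‖curl Ṽ‖²_{L²}` for compactly supported fields, the
`L²` case of the `div`–`curl` estimates; it is the step "According to (4.6) and (4.7), one may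
conclude `∫∫ |∇_a Ṽ|² dϱ dx₃ ≤ c ∫∫ (|χ̃|² + |V^a|²) dϱ dx₃`" of Seregin–Zajaczkowski 2007
(arXiv:math/0702720), proof of Lemma 4.2, for the cut-off poloidal velocity in the meridian
half-plane. Everything here is folklore calculus (integration by parts without boundary terms,
Mathlib's `integral_mul_fderiv_eq_neg_fderiv_mul_of_integrable`, and the symmetry of second
derivatives, Mathlib's `ContDiffAt.isSymmSndFDerivAt`).
-/

noncomputable section

open MeasureTheory Set Function Filter

namespace Literature.Analysis.Calculus

variable {E : Type*} [NormedAddCommGroup E] [NormedSpace ℝ E] [FiniteDimensional ℝ E]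
  [MeasurableSpace E] [BorelSpace E] {μ : Measure E} [μ.IsAddHaarMeasure]

omit [FiniteDimensional ℝ E] [MeasurableSpace E] [BorelSpace E] in
/-- The directional derivative `x ↦ D(Db(x) w)(x) v` of a directional derivative of a `C²`
function is the second derivative `D²b(x) v w`. [folklore] -/
theorem fderiv_fderiv_apply_const {b : E → ℝ} (hb : ContDiff ℝ 2 b) (x v w : E) :
    fderiv ℝ (fun y => fderiv ℝ b y w) x v = fderiv ℝ (fderiv ℝ b) x v w := by
  have hd : DifferentiableAt ℝ (fderiv ℝ b) x :=
    ((hb.fderiv_right (m := 1) (by norm_num)).differentiable (by simp)) x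
  rw [fderiv_clm_apply hd (differentiableAt_const w)]
  simp

omit [FiniteDimensional ℝ E] [MeasurableSpace E] [BorelSpace E] in
/-- A directional derivative of a `C²` function is `C¹`. [folklore] -/
theorem contDiff_one_fderiv_apply_const {b : E → ℝ} (hb : ContDiff ℝ 2 b) (w : E) :
    ContDiff ℝ 1 fun y => fderiv ℝ b y w :=
  (hb.fderiv_right (m := 1) (by norm_num)).clm_apply contDiff_const

omit [FiniteDimensional ℝ E] [MeasurableSpace E] [BorelSpace E] [NormedSpace ℝ E] in
/-- The square of a compactly supported real function has compact support. [folklore] -/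
theorem hasCompactSupport_sq {f : E → ℝ} (hf : HasCompactSupport f) :
    HasCompactSupport fun x => f x ^ 2 := by
  rw [show (fun x => f x ^ 2) = f * f from funext fun x => by simp [sq]]
  exact hf.mul_right

/-- **Mixed products of first derivatives have equal integrals**: for `a ∈ C¹_c(E)`,
`b ∈ C²(E)` and directions `v, w`, `∫ a_v b_w dμ = ∫ a_w b_v dμ` (integrate by parts in `v`,
use `b_{wv} = b_{vw}`, integrate by parts in `w`; no boundary terms since `a` has compact
support). [folklore] -/
theorem integral_fderiv_mul_fderiv_comm {a b : E → ℝ} (ha : ContDiff ℝ 1 a) (hb : ContDiff ℝ 2 b)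
    (hac : HasCompactSupport a) (v w : E) :
    ∫ x, fderiv ℝ a x v * fderiv ℝ b x w ∂μ = ∫ x, fderiv ℝ a x w * fderiv ℝ b x v ∂μ := by
  -- continuity and support bookkeeping
  have hac' : ∀ u : E, HasCompactSupport fun x => fderiv ℝ a x u := fun u =>
    hac.fderiv_apply (𝕜 := ℝ) u
  have hca : Continuous a := ha.continuous
  have hca' : ∀ u : E, Continuous fun x => fderiv ℝ a x u := fun u =>
    (ha.continuous_fderiv one_ne_zero).clm_apply continuous_const
  have hcb' : ∀ u : E, Continuous fun x => fderiv ℝ b x u := fun u =>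
    (contDiff_one_fderiv_apply_const hb u).continuous
  have hcb'' : ∀ u u' : E, Continuous fun x => fderiv ℝ (fun y => fderiv ℝ b y u) x u' :=
    fun u u' => ((contDiff_one_fderiv_apply_const hb u).continuous_fderiv one_ne_zero).clm_apply
      continuous_const
  have hda : ∀ x, DifferentiableAt ℝ a x := fun x => (ha.differentiable one_ne_zero) x
  have hdb' : ∀ (u : E) (x : E), DifferentiableAt ℝ (fun y => fderiv ℝ b y u) x := fun u x =>
    ((contDiff_one_fderiv_apply_const hb u).differentiable one_ne_zero) x
  -- first integration by parts, in the direction `v`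
  have h1 : ∫ x, (fun y => fderiv ℝ b y w) x * fderiv ℝ a x v ∂μ =
      -∫ x, fderiv ℝ (fun y => fderiv ℝ b y w) x v * a x ∂μ := by
    refine integral_mul_fderiv_eq_neg_fderiv_mul_of_integrable ?_ ?_ ?_
      (fun x _ => hdb' w x) (fun x _ => hda x)
    · exact ((hcb'' w v).mul hca).integrable_of_hasCompactSupport hac.mul_left
    · exact ((hcb' w).mul (hca' v)).integrable_of_hasCompactSupport (hac' v).mul_left
    · exact ((hcb' w).mul hca).integrable_of_hasCompactSupport hac.mul_left
  -- second integration by parts, in the direction `w`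
  have h2 : ∫ x, (fun y => fderiv ℝ b y v) x * fderiv ℝ a x w ∂μ =
      -∫ x, fderiv ℝ (fun y => fderiv ℝ b y v) x w * a x ∂μ := by
    refine integral_mul_fderiv_eq_neg_fderiv_mul_of_integrable ?_ ?_ ?_
      (fun x _ => hdb' v x) (fun x _ => hda x)
    · exact ((hcb'' v w).mul hca).integrable_of_hasCompactSupport hac.mul_left
    · exact ((hcb' v).mul (hca' w)).integrable_of_hasCompactSupport (hac' w).mul_left
    · exact ((hcb' v).mul hca).integrable_of_hasCompactSupport hac.mul_left
  -- symmetry of the second derivative of `b`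
  have hsymm : ∀ x, fderiv ℝ (fun y => fderiv ℝ b y w) x v =
      fderiv ℝ (fun y => fderiv ℝ b y v) x w := by
    intro x
    rw [fderiv_fderiv_apply_const hb, fderiv_fderiv_apply_const hb]
    exact (hb.contDiffAt.isSymmSndFDerivAt (by simp)) v w
  calc ∫ x, fderiv ℝ a x v * fderiv ℝ b x w ∂μ
      = ∫ x, (fun y => fderiv ℝ b y w) x * fderiv ℝ a x v ∂μ :=
        integral_congr_ae (Eventually.of_forall fun x => mul_comm _ _)
    _ = -∫ x, fderiv ℝ (fun y => fderiv ℝ b y v) x w * a x ∂μ := by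
        rw [h1]
        simp_rw [hsymm]
    _ = ∫ x, (fun y => fderiv ℝ b y v) x * fderiv ℝ a x w ∂μ := h2.symm
    _ = ∫ x, fderiv ℝ a x w * fderiv ℝ b x v ∂μ :=
        integral_congr_ae (Eventually.of_forall fun x => mul_comm _ _)

/-- **The `div`–`curl` identity.** For `a ∈ C¹_c(E)`, `b ∈ C²_c(E)` and directions `v, w`,
`∫ ((a_v + b_w)² + (a_w - b_v)²) dμ = ∫ (a_v² + a_w² + b_v² + b_w²) dμ`: expanding the squares,
the cross terms `2 (a_v b_w - a_w b_v)` integrate to zero by `integral_fderiv_mul_fderiv_comm`.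
In the plane with `v = e₁`, `w = e₂` and `Ṽ = (a, b)`: `∫ (div Ṽ)² + (curl Ṽ)² = ∫ |∇Ṽ|²`.
[folklore] -/
theorem integral_div_sq_add_curl_sq {a b : E → ℝ} (ha : ContDiff ℝ 1 a) (hb : ContDiff ℝ 2 b)
    (hac : HasCompactSupport a) (hbc : HasCompactSupport b) (v w : E) :
    ∫ x, ((fderiv ℝ a x v + fderiv ℝ b x w) ^ 2 + (fderiv ℝ a x w - fderiv ℝ b x v) ^ 2) ∂μ =
      ∫ x, (fderiv ℝ a x v ^ 2 + fderiv ℝ a x w ^ 2 + fderiv ℝ b x v ^ 2 +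
        fderiv ℝ b x w ^ 2) ∂μ := by
  have hca' : ∀ u : E, Continuous fun x => fderiv ℝ a x u := fun u =>
    (ha.continuous_fderiv one_ne_zero).clm_apply continuous_const
  have hcb' : ∀ u : E, Continuous fun x => fderiv ℝ b x u := fun u =>
    (contDiff_one_fderiv_apply_const hb u).continuous
  have hac' : ∀ u : E, HasCompactSupport fun x => fderiv ℝ a x u := fun u =>
    hac.fderiv_apply (𝕜 := ℝ) u
  have hbc' : ∀ u : E, HasCompactSupport fun x => fderiv ℝ b x u := fun u =>
    hbc.fderiv_apply (𝕜 := ℝ) u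
  -- the integrable pieces
  have iS : Integrable (fun x => fderiv ℝ a x v ^ 2 + fderiv ℝ a x w ^ 2 + fderiv ℝ b x v ^ 2 +
      fderiv ℝ b x w ^ 2) μ := by
    refine ((Integrable.add ?_ ?_).add ?_).add ?_
    · exact ((hca' v).pow 2).integrable_of_hasCompactSupport (hasCompactSupport_sq (hac' v))
    · exact ((hca' w).pow 2).integrable_of_hasCompactSupport (hasCompactSupport_sq (hac' w))
    · exact ((hcb' v).pow 2).integrable_of_hasCompactSupport (hasCompactSupport_sq (hbc' v))
    · exact ((hcb' w).pow 2).integrable_of_hasCompactSupport (hasCompactSupport_sq (hbc' w))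
  have iP : Integrable (fun x => fderiv ℝ a x v * fderiv ℝ b x w) μ :=
    ((hca' v).mul (hcb' w)).integrable_of_hasCompactSupport (hac' v).mul_right
  have iQ : Integrable (fun x => fderiv ℝ a x w * fderiv ℝ b x v) μ :=
    ((hca' w).mul (hcb' v)).integrable_of_hasCompactSupport (hac' w).mul_right
  have hPQ := integral_fderiv_mul_fderiv_comm (μ := μ) ha hb hac v w
  have hpt : ∀ x, (fderiv ℝ a x v + fderiv ℝ b x w) ^ 2 + (fderiv ℝ a x w - fderiv ℝ b x v) ^ 2 =
      (fderiv ℝ a x v ^ 2 + fderiv ℝ a x w ^ 2 + fderiv ℝ b x v ^ 2 + fderiv ℝ b x w ^ 2) +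
        (2 * (fderiv ℝ a x v * fderiv ℝ b x w) - 2 * (fderiv ℝ a x w * fderiv ℝ b x v)) := by
    intro x; ring
  have i2 : Integrable (fun x => 2 * (fderiv ℝ a x v * fderiv ℝ b x w) -
      2 * (fderiv ℝ a x w * fderiv ℝ b x v)) μ := (iP.const_mul 2).sub (iQ.const_mul 2)
  simp_rw [hpt]
  rw [integral_add iS i2, integral_sub (iP.const_mul 2) (iQ.const_mul 2), integral_const_mul,
    integral_const_mul, hPQ, sub_self, add_zero]

end Literature.Analysis.Calculus
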